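import Summits.AtomisticToContinuum.HydrodynamicLimit.Theses.JeansLoadedDice
import Literature.MathematicalPhysics.KineticTheory.HardSphereEulerProofs
import Literature.Analysis.FluidPDE.HardSphereCollisionIntensity
import HarnessLib

/-!
# Birth skeleton (BC3) for crux `JeansLoadedDice.ContactIntensityDominationOneRare` (stmt-AtomisticToContinuum-16939)

Route: `route-AtomisticToContinuum-JeansLoadedDice` (sub-problem `HydrodynamicLimit`; the decl is shared with
`SpeedCapSurgery` as a support item). Crux (rank 6):
`Summit.AtomisticToContinuum.HydrodynamicLimit.Theses.JeansLoadedDice.ContactIntensityDominationOneRare` — the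
ONE-RARE-PARTICIPANT CONTACT-INTENSITY CEILING: along the deterministic hard-sphere flow at fixed reduced density
(`ε_N = hsDiameter σ N = σ(N+1)^{-1/3}`), started from a local Gibbs law `P`, for `N ≥ N₀`, `0 ≤ s ≤ t ≤ T`,
`k ≤ 3` and every continuous mark `ψ : V3 → ℝ≥0∞`,

  `E_P Σ_{collisions (i,j) in (s,t]} ψ(vᵢ⁻)(1+‖vⱼ⁻‖)^k ≤ C · ε_N² · ∫_s^t E_P⊗E_P[Σᵢⱼ ψ(vᵢ)(1+‖v′ⱼ‖)^k ‖vᵢ − v′ⱼ‖] dτ`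

(`σ²(N+1)^{1/3}/(N+1) = ε_N²`; `C` uniform in `ψ`, `k`, the window and `N`).

## The cut registered here (2 stubs + kernel-checked assembly)

The only known road to an Enskog-type ceiling on collision statistics goes through the CONTACT VALUE OF THE PAIR
CORRELATION of the time-`τ` law (BBGKY boundary term / Enskog closure). We cut the crux exactly there, through the
SHELL-FLUX functional of the time-`τ` law (`shellFlux`, thickness `δ`):

  `Sh_δ(τ) = δ⁻¹ · E_P[ Σ_{i≠j} 𝟙{ε ≤ rᵢⱼ ≤ ε+δ, (i,j) incoming} · |ṙᵢⱼ| · ψ(vᵢ)(1+‖vⱼ‖)^k ](Φ_τ z)`,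

`rᵢⱼ = ‖sepVec xᵢ xⱼ‖`, `ṙᵢⱼ = ⟪sepVec, vᵢ − vⱼ⟫/rᵢⱼ` the radial speed (the tree's thin shells `closePair`,
GST2013 Lemma 4.1.2, and `IsIncoming`). It is a ONE-TIME functional of the law `P ∘ Φ_τ⁻¹`: no collision history.

* `stub_campbellShell` — DYNAMICS → ONE-TIME STATICS (Campbell / Palm shell inequality; provable-now, size L): for
  every `0 < σ < 1/2`, every `N`, every hard-sphere flow `Φ` and EVERY probability law `P ≪ Liouville`, every
  window and continuous mark, `collisionMarkSum ≤ liminf_{δ→0⁺} ∫_s^t Sh_δ(τ) dτ`. Mechanism: on a good orbit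
  (finitely many, binary, non-grazing collisions; `IsHardSphereTrajectory`) every collision of `(i,j)` at
  `τ_c ∈ (s,t]` is preceded by a free incoming crossing of the shell `[ε, ε+δ]` on which `∫ δ⁻¹|ṙ| dτ = 1`
  exactly and the velocities are the pre-collisional ones `collidePair i j (Φ_{τ_c} z)` (right-continuous
  orbit, `collidePair` an involution), so pathwise the shell integral dominates the collision sum for all
  `δ < δ₀(z)`; then monotone convergence / Fatou in `δ` and Tonelli (`P` is a `withDensity` of Liouville, a.e.
  orbit is good: `HardSphereFlow.ae_mem_good`; joint measurability `HardSphereFlowJointMeasurable`; finite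
  intensity `HardSphereFlow.lintegral_ncard_collisionTimes_Ioc_le`). Shell crossings that end without a collision
  (a third particle intervenes, or periapsis inside the shell) only help the inequality.
  Why it might fail: only through typing (it is an inequality between `ℝ≥0∞` functionals with no integrability
  needed); the `liminf` over `𝓝[>] 0` is dominated via any sequence `δₙ ↓ 0`.
* `stub_shellCeiling` — THE NEAR-CONTACT ONE-RARE PAIR-CORRELATION CEILING (the open physics, size XL, HARDEST):
  in the crux's frame (continuous positive profiles; `σ < σ₀`; `T > 0`; any flow family; `∃ C < ⊤, N₀`), for
  `N ≥ N₀`, EVERY thickness `0 < δ ≤ ε_N`, every `τ ∈ [0,T]`, `k ≤ 3`, continuous `ψ`: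
  `Sh_δ(τ) ≤ C ε_N² · E_P⊗E_P[Σᵢⱼ ψ(vᵢ)(1+‖v′ⱼ‖)^k ‖vᵢ − v′ⱼ‖](τ)` — the incoming radial flux through the
  thickened contact shell of the EVOLVED local Gibbs law, weighted by one arbitrary mark and a bulk moment of the
  partner, is at most `C ×` its molecular-chaos (two independent copies, spatially averaged) value. This is the
  one-rare form of "`g₂(contact) ≤ C` off equilibrium at positive reduced density": at `τ = 0` (rung ½,
  inhomogeneous local Gibbs statics) it holds `ψ`-uniformly with
  `C ≍ g₂(η)·sup ρ/inf ρ·(θmax/θmin)^{k/2}` (the partner enters only through local bulk moments — exactly why the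
  two-rare predecessor stmt-9218 died and this form survives, `Theorems.not_ContactIntensityDomination`); for
  `τ > 0` it is open (why it might fail: transient dense clusters / rattlers or ring re-collisions making the
  near-contact pair density of a marked fast particle history-dependent at times `O(1)`, the crux's own risk).
  Natural tools: local-Gibbs comparison of the time-`τ` law at scale `ε` (relative entropy is conserved but does
  not see contact values; static large deviations for shell occupancies + a priori moment bounds do), the tree's
  rung-0 Enskog-rate machinery (`InformationPercolationEngineCollisionRate*`, `energyFluxCeilingWindows_rung0`).

Independence (why this is a cut and not a seam): `stub_campbellShell` is pure deterministic kinematics + Fatou,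
true for EVERY absolutely continuous law and carrying no constant; `stub_shellCeiling` is a statement about
one-time marginals of the evolved law and never mentions collision times. Neither is the crux reworded: the crux
counts realised collisions (pairs deflected before contact do not count), the ceiling bounds near-contact
incoming flux at all thicknesses `δ ≤ ε_N`; `crux → stub_shellCeiling` would need "most shell-crossers collide",
`stub_shellCeiling → crux` needs the Campbell stub. BC3 probes (registrar folder `bc/*_probe_*.lean`): for each
stub `S`, `S → ContactIntensityDominationOneRare` and `S → _root_.HydrodynamicLimit` by
`first | exact? | simpa [S] | (unfold S; simpa) | aesop` FAIL.

Assembly `ContactIntensityDominationOneRare_of` (sorry-free, below): `σ₀ := min σ₀(ceiling) ½`; the local Gibbs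
law is a probability measure (`isProbabilityMeasure_localGibbsLaw`, `σ ≤ ½`) and `≪` Liouville (`withDensity`);
chain `collisionMarkSum ≤ liminf_δ ∫ Sh_δ` (Campbell) with `∫_{(s,t]} Sh_δ ≤ C ε² ∫_{(s,t]} productMoment` for
all `δ ∈ (0, ε_N]` (ceiling at each `τ ∈ (s,t] ⊆ [0,T]`, `setLIntegral_mono'`, `lintegral_const_mul'`), and
kill the `liminf` with `liminf_le_of_frequently_le'` on the right-neighbourhood `Ioo 0 ε_N ∈ 𝓝[>] 0`
(`hsDiameter_pos`).

File convention (as `Cruxes/ContactChaos/Lines/birth.lean`): the three functionals are named defs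
(`collisionMarkSum` = the crux's left side verbatim with the law as a parameter, `productMoment` = the crux's
right-side integrand, `shellFlux` = the new intermediate object); each registered stub is a NAMED statement
`def Stubs.stub_<name> : Prop` plus the sorried `theorem stub_<name> : Stubs.stub_<name>`; the assembly takes the
stubs BY NAME and concludes the route decl BY NAME; `…_of_stubs` is the hypothesis-free composition.

Disproof used: none exists for this crux (`ledger crux ls stmt-AtomisticToContinuum-16939`: no workfiles,
2026-08-17). Negatives index honoured: the refuted two-rare form (stmt-9218,
`Theorems.not_SpeedCapSurgery_ContactIntensityDomination` / `not_ContactIntensityDomination`, hot-spot witness with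
TWO rare participants and a `φ`-uniform constant) is not reintroduced — both stubs keep the one-rare mark
structure `ψ(vᵢ)(1+‖vⱼ‖)^k`, `k ≤ 3`; the (α) LOCAL one-copy variant with the mesoscopic scale fixed before `N`
(`Cruxes/EnergyCurrentTails/Lines/level_census_comparison_local_ceiling.lean`, reported to fail the diagonal
hot-spot witness in the route-repair audit attached to this item) is not used either: the ceiling stub keeps the
crux's two-copy right-hand side and only thickens the contact condition microscopically (`δ ≤ ε_N`).
Sources: GST2013 (Prop. 4.1.1, Lemma 4.1.2), CIP1994 §4.2/App. 4.A, Spohn1991 Part I Ch. 3,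
BodineauGallagherSaintRaymondSimonella2023, Alexander1975, Resibois1978 (Enskog contact value).
-/

noncomputable section

namespace Summit.AtomisticToContinuum.HydrodynamicLimit.Cruxes.ContactIntensityDominationOneRare.Birth

open scoped BigOperators ENNReal Topology InnerProductSpace Classical MeasureTheory
open Filter Set MeasureTheory
open Literature.Analysis.FluidPDE Literature.MathematicalPhysics.KineticTheory

/-- Hard-sphere flows of `N + 1` spheres of diameter `ε_N = hsDiameter σ N` on `𝕋³` (the crux's flow type). -/
abbrev Flow (σ : ℝ) (N : ℕ) : Type :=
  HardSphereFlow (Torus.geometry (Fin 3)) (hsDiameter σ N) (N + 1)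

/-- The crux's LEFT side with the law `P` as a parameter: the `P`-expected sum over the collision times in
`(s, t]` of the orbit of the marks `ψ(vᵢ⁻)(1+‖vⱼ⁻‖)^k` of the ordered colliding pair, pre-collisional
velocities read off through `collidePair` (verbatim the crux's integrand). -/
def collisionMarkSum (σ : ℝ) (N : ℕ) (Φ : Flow σ N) (P : Measure (Config (N + 1) (Fin 3) T3))
    (s t : ℝ) (k : ℕ) (ψ : V3 → ℝ≥0∞) : ℝ≥0∞ :=
  ∫⁻ z, (∑ᶠ τ ∈ collisionTimes (Torus.geometry (Fin 3)) (hsDiameter σ N) (fun r => Φ.flow r z) ∩ Set.Ioc s t,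
    ∑ i : Fin (N + 1), ∑ j : Fin (N + 1), if i = j then (0 : ENNReal) else
      (contactSet (Torus.geometry (Fin 3)) (N + 1) (hsDiameter σ N) i j).indicator
        (fun y => (fun p : V3 × V3 => ψ p.1 * ENNReal.ofReal ((1 + ‖p.2‖) ^ k))
          ((((collidePair (Torus.geometry (Fin 3)) i j y)) i).2, (((collidePair (Torus.geometry (Fin 3)) i j y)) j).2))
        (Φ.flow τ z)) ∂P

/-- The crux's RIGHT-side integrand at time `τ` with the law `P` as a parameter: two INDEPENDENT copies `z, z'`,
`E_P⊗E_P[Σᵢⱼ ψ(vᵢ(τ,z)) (1+‖vⱼ(τ,z')‖)^k ‖vᵢ(τ,z) − vⱼ(τ,z')‖]` (verbatim the crux's integrand). -/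
def productMoment (σ : ℝ) (N : ℕ) (Φ : Flow σ N) (P : Measure (Config (N + 1) (Fin 3) T3))
    (τ : ℝ) (k : ℕ) (ψ : V3 → ℝ≥0∞) : ℝ≥0∞ :=
  ∫⁻ z, ∫⁻ z', (∑ i : Fin (N + 1), ∑ j : Fin (N + 1),
    ψ (((Φ.flow τ z) i).2) * ENNReal.ofReal ((1 + ‖((Φ.flow τ z') j).2‖) ^ k) *
      ENNReal.ofReal ‖((Φ.flow τ z) i).2 - ((Φ.flow τ z') j).2‖) ∂P ∂P

/-- The SHELL-FLUX functional of the time-`τ` law (the intermediate object of the cut): thickness `δ > 0`,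
`Sh_δ(τ) = E_P[ Σ_{i≠j} 𝟙{ε ≤ ‖sep(xᵢ,xⱼ)‖ ≤ ε+δ, (i,j) incoming} · |⟪sep, vᵢ−vⱼ⟫|/(‖sep‖·δ) · ψ(vᵢ)(1+‖vⱼ‖)^k ](Φ_τ z)`
— the normalised incoming radial flux through the thin shell `closePair … ε δ i j` (GST2013 Lemma 4.1.2) with the
crux's one-rare marks read at the CURRENT velocities. A one-time functional of `P ∘ Φ_τ⁻¹`. -/
def shellFlux (σ : ℝ) (N : ℕ) (Φ : Flow σ N) (P : Measure (Config (N + 1) (Fin 3) T3))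
    (δ τ : ℝ) (k : ℕ) (ψ : V3 → ℝ≥0∞) : ℝ≥0∞ :=
  ∫⁻ z, (∑ i : Fin (N + 1), ∑ j : Fin (N + 1), if i = j then (0 : ENNReal) else
    (closePair (N + 1) (Fin 3) (hsDiameter σ N) δ i j ∩
        {y | IsIncoming (Torus.geometry (Fin 3)) y i j}).indicator
      (fun y => ENNReal.ofReal (|⟪(Torus.geometry (Fin 3)).sepVec (y i).1 (y j).1, (y i).2 - (y j).2⟫_ℝ| /
          (‖(Torus.geometry (Fin 3)).sepVec (y i).1 (y j).1‖ * δ)) *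
        (ψ (y i).2 * ENNReal.ofReal ((1 + ‖(y j).2‖) ^ k)))
      (Φ.flow τ z)) ∂P

/-- stub 1 — CAMPBELL SHELL INEQUALITY (dynamics → one-time statics). For `0 < σ < 1/2`, every `N`, every
hard-sphere flow `Φ` of `N + 1` spheres of diameter `ε_N` on `𝕋³`, every PROBABILITY law `P ≪ Liouville`, every
window `(s, t]`, exponent `k` and continuous mark `ψ`, the expected marked collision sum is at most the `liminf` as
`δ → 0⁺` of the time-integrated shell flux: `collisionMarkSum ≤ liminf_{δ→0⁺} ∫_{(s,t]} Sh_δ(τ) dτ`.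
Why plausibly true: pathwise on good orbits each collision is preceded by a free incoming crossing of the shell
carrying unit normalised flux and the pre-collisional marks; Fatou + Tonelli. Size L (collision-record
measurability is in the tree: `HardSphereCollisionRecordMeasurable`, `HardSphereFlowJointMeasurable`).
Leans on: `HardSphereFlow`, `IsHardSphereTrajectory`, `collisionTimes`, `contactSet`, `collidePair`, `closePair`,
`IsIncoming`, `liouville`, `HardSphereFlow.lintegral_ncard_collisionTimes_Ioc_le`; sources GST2013 Prop. 4.1.1,
CIP1994 App. 4.A (special-flow / Palm representation over the collision boundary). -/
def Stubs.stub_campbellShell : Prop :=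
  ∀ σ : ℝ, 0 < σ → σ < 2⁻¹ → ∀ (N : ℕ) (Φ : Flow σ N) (P : Measure (Config (N + 1) (Fin 3) T3)),
    IsProbabilityMeasure P → P ≪ liouville (Torus.geometry (Fin 3)) (N + 1) (hsDiameter σ N) →
    ∀ (s t : ℝ) (k : ℕ) (ψ : V3 → ℝ≥0∞), Continuous ψ →
      collisionMarkSum σ N Φ P s t k ψ ≤
        Filter.liminf (fun δ : ℝ => ∫⁻ τ in Set.Ioc s t, shellFlux σ N Φ P δ τ k ψ) (𝓝[>] (0 : ℝ))

/-- Registered stub 1 (`Stubs.stub_campbellShell`): the `sorry` to be discharged. -/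
theorem stub_campbellShell : Stubs.stub_campbellShell := by
  sorry

/-- stub 2 — NEAR-CONTACT ONE-RARE PAIR-CORRELATION CEILING for the evolved local Gibbs law (the open physics;
HARDEST stub). Crux frame: for continuous positive profiles there is `σ₀ > 0` such that for `0 < σ < σ₀`, every
`T > 0` and every flow family `Φ`, there are `C < ⊤` and `N₀` with: for `N ≥ N₀`, EVERY shell thickness
`0 < δ ≤ ε_N`, every `τ ∈ [0, T]`, `k ≤ 3` and continuous `ψ`,
`Sh_δ(τ) ≤ C · ε_N² · E_P⊗E_P[Σᵢⱼ ψ(vᵢ)(1+‖v′ⱼ‖)^k ‖vᵢ − v′ⱼ‖](τ)` with `P` the local Gibbs law — the incoming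
flux through the thickened contact shell, weighted by ONE arbitrary mark and a bulk moment of the partner, is at
most `C ×` its two-independent-copies value (`ε_N²` written as `σ²(N+1)^{1/3}/(N+1)` as in the crux).
Why plausibly true: rung ½ (τ = 0) holds ψ-uniformly with `C ≍ g₂ · sup ρ/inf ρ · (θmax/θmin)^{k/2}`; it is the
Enskog closure bound every kinetic description of the dense gas presupposes. Why it might fail: off equilibrium a
history-dependent near-contact pair density of marked fast particles (rattler clusters, ring re-collisions) at
times `O(1)` — the crux's own risk, now isolated from all collision bookkeeping. Size XL / open-problem.
Leans on: `localGibbsLaw`, `closePair`, `IsIncoming`, `hsDiameter`; sources Spohn1991 Part I Ch. 3, Resibois1978,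
GST2013, BodineauGallagherSaintRaymondSimonella2023. -/
def Stubs.stub_shellCeiling : Prop :=
  ∀ (a₀ θ₀ : T3 → ℝ) (u₀ : T3 → V3), Continuous a₀ → Continuous θ₀ → Continuous u₀ →
    (∀ x, 0 < a₀ x) → (∀ x, 0 < θ₀ x) →
    ∃ σ₀ : ℝ, 0 < σ₀ ∧ ∀ σ : ℝ, 0 < σ → σ < σ₀ → ∀ T : ℝ, 0 < T → ∀ Φ : ((N : ℕ) → Flow σ N),
      ∃ C : ℝ≥0∞, C < ⊤ ∧ ∃ N₀ : ℕ, ∀ N : ℕ, N₀ ≤ N → ∀ δ : ℝ, 0 < δ → δ ≤ hsDiameter σ N →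
        ∀ τ : ℝ, 0 ≤ τ → τ ≤ T → ∀ k : ℕ, k ≤ 3 → ∀ ψ : V3 → ℝ≥0∞, Continuous ψ →
          shellFlux σ N (Φ N) (localGibbsLaw σ a₀ u₀ θ₀ N (Φ N)) δ τ k ψ ≤
            C * ENNReal.ofReal ((σ ^ 2 * ((N + 1 : ℕ) : ℝ) ^ ((1 : ℝ) / 3)) / ((N + 1 : ℕ) : ℝ)) *
              productMoment σ N (Φ N) (localGibbsLaw σ a₀ u₀ θ₀ N (Φ N)) τ k ψ

/-- Registered stub 2 (`Stubs.stub_shellCeiling`): the `sorry` to be discharged. -/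
theorem stub_shellCeiling : Stubs.stub_shellCeiling := by
  sorry

/-- ASSEMBLY (kernel-checked, no `sorry`): the two stubs, taken BY NAME, give the crux BY NAME.
`σ₀ := min σ₀(ceiling) ½`; the local Gibbs law is a probability measure absolutely continuous w.r.t. Liouville,
so the Campbell stub applies to it; on `(s, t] ⊆ [0, T]` the ceiling bounds the shell flux at every time by
`C ε² · productMoment`, uniformly in the thickness `δ ∈ (0, ε_N]`; integrate in `τ` (`setLIntegral_mono'`,
`lintegral_const_mul'`) and bound the `liminf` over `δ → 0⁺` by its eventual upper bound
(`liminf_le_of_frequently_le'`, `Ioo 0 ε_N ∈ 𝓝[>] 0`). -/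
theorem ContactIntensityDominationOneRare_of :
    Stubs.stub_campbellShell → Stubs.stub_shellCeiling →
      Summit.AtomisticToContinuum.HydrodynamicLimit.Theses.JeansLoadedDice.ContactIntensityDominationOneRare := by
  intro hFlux hCeil a₀ θ₀ u₀ ha hθ hu hapos hθpos
  obtain ⟨σ₀, hσ₀, H⟩ := hCeil a₀ θ₀ u₀ ha hθ hu hapos hθpos
  refine ⟨min σ₀ 2⁻¹, lt_min hσ₀ (by norm_num), ?_⟩
  intro σ hσ hσlt T hT Φ
  have hσ₁ : σ < σ₀ := lt_of_lt_of_le hσlt (min_le_left _ _)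
  have hσ₂ : σ < 2⁻¹ := lt_of_lt_of_le hσlt (min_le_right _ _)
  have hσ₂' : σ ≤ 1 / 2 := by rw [one_div]; exact hσ₂.le
  obtain ⟨C, hC, N₀, HN⟩ := H σ hσ hσ₁ T hT Φ
  refine ⟨C, hC, N₀, ?_⟩
  intro N hN s t hs hst htT k hk ψ hψ
  set P : Measure (Config (N + 1) (Fin 3) T3) := localGibbsLaw σ a₀ u₀ θ₀ N (Φ N) with hP
  set K : ℝ≥0∞ := C * ENNReal.ofReal ((σ ^ 2 * ((N + 1 : ℕ) : ℝ) ^ ((1 : ℝ) / 3)) / ((N + 1 : ℕ) : ℝ))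
    with hK
  have hKtop : K ≠ ⊤ := ENNReal.mul_ne_top hC.ne ENNReal.ofReal_ne_top
  have hprob : IsProbabilityMeasure P :=
    isProbabilityMeasure_localGibbsLaw ha hθ hu hapos hθpos hσ₂' N (Φ N)
  have hac : P ≪ liouville (Torus.geometry (Fin 3)) (N + 1) (hsDiameter σ N) :=
    withDensity_absolutelyContinuous _ _
  -- (1) Campbell: collisions ≤ liminf of the time-integrated shell flux
  have h1 : collisionMarkSum σ N (Φ N) P s t k ψ ≤
      Filter.liminf (fun δ : ℝ => ∫⁻ τ in Set.Ioc s t, shellFlux σ N (Φ N) P δ τ k ψ) (𝓝[>] (0 : ℝ)) :=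
    hFlux σ hσ hσ₂ N (Φ N) P hprob hac s t k ψ hψ
  -- (2) ceiling, integrated over the window, for every admissible thickness
  have h2 : ∀ δ : ℝ, 0 < δ → δ ≤ hsDiameter σ N →
      ∫⁻ τ in Set.Ioc s t, shellFlux σ N (Φ N) P δ τ k ψ ≤
        K * ∫⁻ τ in Set.Ioc s t, productMoment σ N (Φ N) P τ k ψ := by
    intro δ hδ hδε
    calc ∫⁻ τ in Set.Ioc s t, shellFlux σ N (Φ N) P δ τ k ψ
        ≤ ∫⁻ τ in Set.Ioc s t, K * productMoment σ N (Φ N) P τ k ψ :=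
          setLIntegral_mono' measurableSet_Ioc fun τ hτ =>
            HN N hN δ hδ hδε τ (hs.trans hτ.1.le) (hτ.2.trans htT) k hk ψ hψ
      _ = K * ∫⁻ τ in Set.Ioc s t, productMoment σ N (Φ N) P τ k ψ :=
          lintegral_const_mul' K _ hKtop
  -- (3) the liminf over δ → 0⁺ is below the eventual upper bound
  have h3 : Filter.liminf (fun δ : ℝ => ∫⁻ τ in Set.Ioc s t, shellFlux σ N (Φ N) P δ τ k ψ) (𝓝[>] (0 : ℝ)) ≤
      K * ∫⁻ τ in Set.Ioc s t, productMoment σ N (Φ N) P τ k ψ := by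
    refine Filter.liminf_le_of_frequently_le' (Filter.Eventually.frequently ?_)
    filter_upwards [Ioo_mem_nhdsGT (hsDiameter_pos hσ N)] with δ hδ
    exact h2 δ hδ.1 hδ.2.le
  exact h1.trans h3

/-- The crux from the two registered stubs (hypothesis-free composition; inherits the stubs' `sorry`s, states
nothing new; type-checks that the sorried theorems are literally the named hypotheses of the assembly). -/
theorem ContactIntensityDominationOneRare_of_stubs :
    Summit.AtomisticToContinuum.HydrodynamicLimit.Theses.JeansLoadedDice.ContactIntensityDominationOneRare :=
  ContactIntensityDominationOneRare_of stub_campbellShell stub_shellCeiling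

end Summit.AtomisticToContinuum.HydrodynamicLimit.Cruxes.ContactIntensityDominationOneRare.Birth

end
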